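import Literature.NumberTheory.EllipticCurves.KugaSatoSchollProjectorFrobInfty
import Literature.AlgebraicGeometry.Motives.RestrictScalarsBettiNaturality
import Mathlib.NumberTheory.NumberField.Basic
import HarnessLib

/-!
# Scholl's projector on `Hⁱ_B(W|_ℚ) ≅ ∏_σ Hⁱ_B(W_σ)`: the `ε`-part component by component

Topic: `Literature/NumberTheory/EllipticCurves`. A Kuga–Sato variety `V : KugaSatoVariety K m N` of
the tree lives over a number field `K ∋ ζ_N`; Scholl's `ℚ`-scheme is `W|_ℚ`
(`KugaSatoSchollProjectorFrobInfty.lean`), whose complex points are the disjoint union of the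
conjugate complex manifolds `W_σ(ℂ)`, `σ : K → ℂ` (Deninger–Scholl 1991, §4.1: `M_n ⊗ ℂ` is "the
disjoint union of `φ(n)` copies of `Γ(n)∖ℍ`"), so that
`Hⁱ_B(W|_ℚ) ≅ ∏_σ Hⁱ_B(W_σ)` (`Motives.bettiCohomologyRestrictScalarsEquiv`). Scholl's group of
automorphisms of `W` (Deninger–Scholl 5.3 (i)) acts on all three: on `W` over `K`, on `W|_ℚ`
(`autRestrict`) and on each conjugate `W_σ = W ⊗_{K,σ} ℂ` (`autConj`, base change). This file
records that the decomposition intertwines these actions, hence Scholl's projector `Π_ε`: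

* `KugaSatoVariety.conj V σ = W_σ`, `autConj V σ : Aut W →* Aut W_σ` (Mathlib `Functor.mapAut`
  of `Motives.baseChangeHom σ`), `bettiActionConj V σ i : ℚ[Aut W] →ₐ[ℚ] End_ℚ Hⁱ_B(W_σ)`,
  `schollProjectorBettiConj V σ i = bettiActionConj Π_ε` (idempotent) and its image
  `schollPartConj V σ i`;
* `decomp_bettiActionRat` — **the decomposition is `ℚ[Aut W]`-linear**:
  `decomp (a • x) σ = a • decomp x σ` (from the naturality of the decomposition,
  `Motives.bettiCohomologyRestrictScalarsEquiv_map_mapAut_inv`, extended linearly);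
* `decomp_schollProjectorBettiRat` — `decomp (Π_ε x) σ = Π_ε (decomp x σ)`;
* `mem_schollPartRat_iff_forall_conj` and **`schollPartRatEquiv V i :
  Π_ε Hⁱ_B(W|_ℚ) ≃ₗ[ℚ] ∏_σ Π_ε Hⁱ_B(W_σ)`** — the `ε`-part of the cohomology of Scholl's
  `ℚ`-scheme is the product over the embeddings of the `ε`-parts of the conjugate components
  (the shape of Deninger–Scholl 5.1–5.3: parabolic cohomology of level `n` over `ℚ` versus over
  `ℂ`, component by component; no identification with parabolic cohomology is asserted here).

`K` is a number field (`[NumberField K]`: `[K : ℚ] < ∞` is needed for the decomposition);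
hypothesis `[IsCommMonObj V.curve.E]` as in the companion files; no named facts.

## References

* C. Deninger, A. J. Scholl, *The Beilinson conjectures*, in *L-functions and Arithmetic*,
  LMS LNS 153 (1991), §4.1 (p. 161 of the volume), 5.1, 5.3 (i) (p. 167). [DeningerScholl1991]
* A. J. Scholl, *Motives for modular forms*, Invent. Math. 100 (1990), §1. [Scholl1990]
-/

open CategoryTheory Limits AlgebraicGeometry MonoidalCategory CartesianMonoidalCategory
open scoped MonObj MatrixGroups

noncomputable section

namespace Literature.NumberTheory.EllipticCurves

namespace KugaSatoVariety

open Literature.AlgebraicGeometry.Motives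

variable {K : Type} [Field K] [NumberField K] {m N : ℕ} (V : KugaSatoVariety K m N)

/-! ### The conjugate components `W_σ` and the action of `Aut W` on them -/

/-- **The conjugate component `W_σ = W ⊗_{K,σ} ℂ`** of `W` along a `ℚ`-embedding `σ : K → ℂ`
(`Motives.baseChangeHom`; Deninger–Scholl §4.1: the `φ(n)` components of `M_n ⊗ ℂ`).
[cite: DeningerScholl1991, §4.1] -/
abbrev conj (σ : K →ₐ[ℚ] ℂ) : SchemeOver ℂ :=
  (baseChangeHom σ.toRingHom).obj V.W

/-- **`Aut W → Aut W_σ`**: a `K`-automorphism of `W` base-changes to a `ℂ`-automorphism of `W_σ`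
(Mathlib `Functor.mapAut` of `Motives.baseChangeHom σ`). [folklore] -/
abbrev autConj (σ : K →ₐ[ℚ] ℂ) : Aut V.W →* Aut (V.conj σ) :=
  (baseChangeHom σ.toRingHom).mapAut V.W

/-- `(autConj σ g).hom = (g.hom)_σ`. [folklore] -/
theorem autConj_hom (σ : K →ₐ[ℚ] ℂ) (g : Aut V.W) :
    (V.autConj σ g).hom = (baseChangeHom σ.toRingHom).map g.hom :=
  rfl

/-- `(autConj σ g).inv = (g.inv)_σ`. [folklore] -/
theorem autConj_inv (σ : K →ₐ[ℚ] ℂ) (g : Aut V.W) :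
    (V.autConj σ g).inv = (baseChangeHom σ.toRingHom).map g.inv :=
  rfl

/-- **`ℚ[Aut W]` acts on `Hⁱ_B(W_σ)`**: `[g] ↦ ((g_σ)⁻¹)*`. [folklore] -/
def bettiActionConj (σ : K →ₐ[ℚ] ℂ) (i : ℕ) :
    MonoidAlgebra ℚ (Aut V.W) →ₐ[ℚ] Module.End ℚ (bettiCohomology (V.conj σ) i) :=
  MonoidAlgebra.lift ℚ _ (Aut V.W) ((autBettiRepOver (V.conj σ) i).comp (V.autConj σ))

/-- `bettiActionConj σ [g] = ((g_σ)⁻¹)*`. [folklore] -/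
@[simp]
theorem bettiActionConj_of (σ : K →ₐ[ℚ] ℂ) (i : ℕ) (g : Aut V.W) :
    V.bettiActionConj σ i (MonoidAlgebra.of ℚ _ g) =
      (bettiCohomology.map (V.autConj σ g).inv i).hom :=
  MonoidAlgebra.lift_of _ _

/-- Pull-back along `g_σ` in terms of the action: `(g_σ)* = bettiActionConj σ [g⁻¹]`. [folklore] -/
theorem map_autConj_hom_eq_bettiActionConj (σ : K →ₐ[ℚ] ℂ) (i : ℕ) (g : Aut V.W) :
    (bettiCohomology.map (V.autConj σ g).hom i).hom =
      V.bettiActionConj σ i (MonoidAlgebra.of ℚ _ g⁻¹) := by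
  rw [bettiActionConj_of, map_inv]
  rfl

/-! ### The decomposition `Hⁱ_B(W|_ℚ) ≅ ∏_σ Hⁱ_B(W_σ)` is `ℚ[Aut W]`-linear -/

/-- **The decomposition `Hⁱ_B(W|_ℚ) ≅ ∏_σ Hⁱ_B(W_σ)` intertwines the actions of `ℚ[Aut W]`**:
`decomp (a • x) σ = a • (decomp x σ)` for every `a ∈ ℚ[Aut W]` (naturality of the decomposition
under `K`-automorphisms, `Motives.bettiCohomologyRestrictScalarsEquiv_map_mapAut_inv`, extended
by linearity). [cite: DeningerScholl1991, §4.1 and 5.3 (i)] -/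
theorem decomp_bettiActionRat (i : ℕ) (a : MonoidAlgebra ℚ (Aut V.W))
    (x : bettiCohomology (V.W.restrictScalars ℚ) i) (σ : K →ₐ[ℚ] ℂ) :
    bettiCohomologyRestrictScalarsEquiv V.W i (V.bettiActionRat i a x) σ =
      V.bettiActionConj σ i a (bettiCohomologyRestrictScalarsEquiv V.W i x σ) := by
  induction a using MonoidAlgebra.induction_on with
  | hM g =>
    rw [bettiActionRat_of, bettiActionConj_of]
    exact bettiCohomologyRestrictScalarsEquiv_map_mapAut_inv g i x σ
  | hadd a b ha hb =>
    rw [map_add, map_add, LinearMap.add_apply, LinearMap.add_apply, LinearEquiv.map_add,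
      Pi.add_apply, ha, hb]
  | hsmul r a ha =>
    rw [map_smul, map_smul, LinearMap.smul_apply, LinearMap.smul_apply, LinearEquiv.map_smul,
      Pi.smul_apply, ha]

/-! ### Scholl's projector on the conjugate components -/

/-- **Scholl's projector `Π_ε` acting on `Hⁱ_B(W_σ)`**, the Betti cohomology of the conjugate
component `W_σ` (Deninger–Scholl 5.3 (i), for each of the `φ(n)` components of §4.1).
[cite: DeningerScholl1991, 5.3 (i)] -/
def schollProjectorBettiConj [NeZero N] [IsCommMonObj V.curve.E] (σ : K →ₐ[ℚ] ℂ) (i : ℕ) :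
    bettiCohomology (V.conj σ) i →ₗ[ℚ] bettiCohomology (V.conj σ) i :=
  V.bettiActionConj σ i V.schollProjector

/-- `Π_ε` is idempotent on `Hⁱ_B(W_σ)`. [cite: DeningerScholl1991, 5.3 (i)] -/
theorem isIdempotentElem_schollProjectorBettiConj [NeZero N] [IsCommMonObj V.curve.E]
    (σ : K →ₐ[ℚ] ℂ) (i : ℕ) : IsIdempotentElem (V.schollProjectorBettiConj σ i) :=
  V.isIdempotentElem_schollProjector.map (V.bettiActionConj σ i)

/-- `Π_ε (Π_ε y) = Π_ε y` on `Hⁱ_B(W_σ)`. [cite: DeningerScholl1991, 5.3 (i)] -/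
theorem schollProjectorBettiConj_apply_apply [NeZero N] [IsCommMonObj V.curve.E]
    (σ : K →ₐ[ℚ] ℂ) (i : ℕ) (y : bettiCohomology (V.conj σ) i) :
    V.schollProjectorBettiConj σ i (V.schollProjectorBettiConj σ i y) =
      V.schollProjectorBettiConj σ i y :=
  LinearMap.congr_fun (V.isIdempotentElem_schollProjectorBettiConj σ i).eq y

/-- **The `ε`-part `Π_ε Hⁱ_B(W_σ)`** of the Betti cohomology of the conjugate component `W_σ`.
[cite: DeningerScholl1991, 5.3 (i)] -/
def schollPartConj [NeZero N] [IsCommMonObj V.curve.E] (σ : K →ₐ[ℚ] ℂ) (i : ℕ) :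
    Submodule ℚ (bettiCohomology (V.conj σ) i) :=
  LinearMap.range (V.schollProjectorBettiConj σ i)

/-- `y ∈ Π_ε Hⁱ_B(W_σ) ↔ Π_ε y = y`. [folklore] -/
theorem mem_schollPartConj_iff [NeZero N] [IsCommMonObj V.curve.E] (σ : K →ₐ[ℚ] ℂ) (i : ℕ)
    (y : bettiCohomology (V.conj σ) i) :
    y ∈ V.schollPartConj σ i ↔ V.schollProjectorBettiConj σ i y = y := by
  constructor
  · intro hy
    obtain ⟨z, rfl⟩ := LinearMap.mem_range.mp hy
    exact V.schollProjectorBettiConj_apply_apply σ i z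
  · intro hy
    exact LinearMap.mem_range.mpr ⟨y, hy⟩

/-- **`decomp (Π_ε x) σ = Π_ε (decomp x σ)`**: Scholl's projector on `Hⁱ_B(W|_ℚ)` is, component by
component, Scholl's projector on the conjugate components. [cite: DeningerScholl1991, §4.1 and 5.3 (i)] -/
theorem decomp_schollProjectorBettiRat [NeZero N] [IsCommMonObj V.curve.E] (i : ℕ)
    (x : bettiCohomology (V.W.restrictScalars ℚ) i) (σ : K →ₐ[ℚ] ℂ) :
    bettiCohomologyRestrictScalarsEquiv V.W i (V.schollProjectorBettiRat i x) σ =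
      V.schollProjectorBettiConj σ i (bettiCohomologyRestrictScalarsEquiv V.W i x σ) :=
  V.decomp_bettiActionRat i V.schollProjector x σ

/-- **`x ∈ Π_ε Hⁱ_B(W|_ℚ)` iff every component `decomp x σ` lies in `Π_ε Hⁱ_B(W_σ)`.**
[cite: DeningerScholl1991, §4.1 and 5.3 (i)] -/
theorem mem_schollPartRat_iff_forall_conj [NeZero N] [IsCommMonObj V.curve.E] (i : ℕ)
    (x : bettiCohomology (V.W.restrictScalars ℚ) i) :
    x ∈ V.schollPartRat i ↔
      ∀ σ : K →ₐ[ℚ] ℂ, bettiCohomologyRestrictScalarsEquiv V.W i x σ ∈ V.schollPartConj σ i := by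
  rw [mem_schollPartRat_iff]
  constructor
  · intro hx σ
    rw [mem_schollPartConj_iff, ← decomp_schollProjectorBettiRat, hx]
  · intro hx
    apply (bettiCohomologyRestrictScalarsEquiv V.W i).injective
    funext σ
    rw [decomp_schollProjectorBettiRat]
    exact (V.mem_schollPartConj_iff σ i _).mp (hx σ)

/-- **The `ε`-part of `Hⁱ_B(W|_ℚ)` is the product of the `ε`-parts of the conjugate components**:
`Π_ε Hⁱ_B(W|_ℚ) ≃ₗ[ℚ] ∏_{σ : K → ℂ} Π_ε Hⁱ_B(W_σ)`, the restriction of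
`Motives.bettiCohomologyRestrictScalarsEquiv` (Deninger–Scholl §4.1, 5.1–5.3: the cohomology of
Scholl's `ℚ`-scheme decomposes over the `φ(n)` geometric components, compatibly with `Π`).
[cite: DeningerScholl1991, §4.1 and 5.3 (i)] -/
def schollPartRatEquiv [NeZero N] [IsCommMonObj V.curve.E] (i : ℕ) :
    V.schollPartRat i ≃ₗ[ℚ] ∀ σ : K →ₐ[ℚ] ℂ, V.schollPartConj σ i where
  toFun x σ := ⟨bettiCohomologyRestrictScalarsEquiv V.W i (x : bettiCohomology (V.W.restrictScalars ℚ) i) σ,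
    (V.mem_schollPartRat_iff_forall_conj i x).mp x.2 σ⟩
  map_add' x y := by
    funext σ
    apply Subtype.ext
    change bettiCohomologyRestrictScalarsEquiv V.W i
        ((x : bettiCohomology (V.W.restrictScalars ℚ) i) + (y : bettiCohomology _ i)) σ =
      bettiCohomologyRestrictScalarsEquiv V.W i (x : bettiCohomology (V.W.restrictScalars ℚ) i) σ +
        bettiCohomologyRestrictScalarsEquiv V.W i (y : bettiCohomology (V.W.restrictScalars ℚ) i) σ
    rw [LinearEquiv.map_add, Pi.add_apply]
  map_smul' r x := by
    funext σ
    apply Subtype.ext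
    change bettiCohomologyRestrictScalarsEquiv V.W i
        (r • (x : bettiCohomology (V.W.restrictScalars ℚ) i)) σ =
      r • bettiCohomologyRestrictScalarsEquiv V.W i (x : bettiCohomology (V.W.restrictScalars ℚ) i) σ
    rw [LinearEquiv.map_smul, Pi.smul_apply]
  invFun y := ⟨(bettiCohomologyRestrictScalarsEquiv V.W i).symm fun σ => (y σ : bettiCohomology _ i),
    (V.mem_schollPartRat_iff_forall_conj i _).mpr fun σ => by
      rw [LinearEquiv.apply_symm_apply]
      exact (y σ).2⟩
  left_inv x := by
    apply Subtype.ext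
    change (bettiCohomologyRestrictScalarsEquiv V.W i).symm
        (bettiCohomologyRestrictScalarsEquiv V.W i (x : bettiCohomology (V.W.restrictScalars ℚ) i)) =
      (x : bettiCohomology (V.W.restrictScalars ℚ) i)
    exact (bettiCohomologyRestrictScalarsEquiv V.W i).symm_apply_apply _
  right_inv y := by
    funext σ
    apply Subtype.ext
    change bettiCohomologyRestrictScalarsEquiv V.W i
        ((bettiCohomologyRestrictScalarsEquiv V.W i).symm fun τ => (y τ : bettiCohomology _ i)) σ =
      (y σ : bettiCohomology _ i)
    rw [LinearEquiv.apply_symm_apply]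

/-- The `σ`-component of `schollPartRatEquiv x` is `decomp x σ`. [folklore] -/
@[simp]
theorem schollPartRatEquiv_apply_coe [NeZero N] [IsCommMonObj V.curve.E] (i : ℕ)
    (x : V.schollPartRat i) (σ : K →ₐ[ℚ] ℂ) :
    (V.schollPartRatEquiv i x σ : bettiCohomology (V.conj σ) i) =
      bettiCohomologyRestrictScalarsEquiv V.W i (x : bettiCohomology (V.W.restrictScalars ℚ) i) σ :=
  rfl

end KugaSatoVariety

end Literature.NumberTheory.EllipticCurves

end
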